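import Summits.QuantumFields.YangMills.Theorems.BalabanUVNodesK0AxCtabJRows
import Summits.QuantumFields.YangMills.Theorems.BalabanUVNodesK0RecordFormatNamesOrbit
import Summits.QuantumFields.YangMills.Theorems.BalabanUVNodesK0AxJoinTDressed

/-!
# NODE O · K0ᴬ — ★★ №541 (R-a) BRIDGE: `DressLink` FROM THE ORBIT RECEIPT (C-orb) + C²-ENTRIES (TokP9reg♭), AND [E] FROM (C-orb)

LANDING NOTE (porter ▶ PTC-1 g4, 2026-08-31; AUTHORSHIP = ◇ lens-1 g10 «cauchy-analytic», HOME sketch `nodeO-cover/LENS-1g10-Rb-4-DressLinkOrbit.lean` sha16 bd2831b490c5400e · 158 l. · 2 thm · 0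
def · 0 sorry): landed VERBATIM (only this paragraph added) under the basename ◇ lens-1 proposed (`…K0AxDressLinkOrbit`), after PART B-3 ✓`…K0AxJoinTDressed` (v2 binder order, which this file's §2
call uses), on ★★★ director-ym №541 (R-a) ∕ №543 (2) ((C-orb) `RootedResponseOrbitAt` = the supplier of `DressLink`) and ◆ CRIT-1 g36's ADDENDUM STAMP «(B-4) PASS — GO» ((Q-ord) PASS, J5′ 0 HIT,
J1′ ✓, Federbush ✓, axioms standard on ◆'s concatenated run `LENS-1g10-Rb-scratchALL-v2.lean` fb6f6aafecfc4fb6; nodeO STATUS 09:50:31Z); ◇ lens-1's later (B-4) v2 d1ac595695e0a02f (B-3-free,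
statements identical, proof inlines B-3's assembly) stays a HOME twin; helper `--supports stmt-QuantumFields-27238 --as helper` (NO `--workitem`).  HONEST (porter): a bridge + a CONDITIONAL
assembly over DISPLAYED rows ((C-orb) mod P0, TokP9reg♭ C²-entries, D1 = ⟨27930⟩'s ⁸ consequent, (Tok-cmpU-cap) — all OPEN, asserted nowhere); [E] inhabited unconditionally NOWHERE; nothing of
Bałaban asserted, ported, discharged or refuted; K0ᴬ stmt-QuantumFields-27238 OPEN — NOTHING of it proved; NODE O 0∕1; COUNT 8∕28 · K 1∕4 UNMOVED; finite 𝕋⁴ at fixed ε — NOT continuum ∕ OS ∕ Clay;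
the Yang–Mills mass gap is NOT proved by any of this.

◇ `ymgap-nodeO-lens-1` g10 (planner; typed for the porter ▶ PTC-1 g4; lands AFTER PART B-3 `…K0AxJoinTDressed`; target
`Summits/QuantumFields/YangMills/Theorems/BalabanUVNodesK0AxDressLinkOrbit.lean` `--supports stmt-QuantumFields-27238 --as helper`).  Items: K0ᴬ 27238 OPEN; K0⁷ 20541 OPEN.

§1 ★★ `dressLink_of_orbit` — THE SUPPLIER OF `DressLink` IS (C-orb): at `θ := thetaFill F a₀ ε₂₉` (`0 < a₀`), on the standing range `k + 1 ≤ m + K`, given C² ENTRIES of the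
rooted background field at `B = 0` (TokP9reg♭ := `ContDiffAt ℝ 2`; one `.contDiffAt` below 27931⁷'s displayed TokP9reg `AnalyticAt ℝ …`) and the DISPLAYED orbit receipt
`∀ a l, RootedResponseOrbitAt F θ k K a l` (DEF-1 ed.21: `recordD − recordHrLocξ univ = φ(b₊) − φ(b₋)`), THE DRESSING POTENTIAL `φ′ l a := sl2Coord ∘ Matrix.of ∘ φ_{a,l}`
SATISFIES `DressLink F θ k K φ′`.  Mechanism (no new mathematics): 𝐔-rows — `recordGkJ (b, 𝐔, c) = sl2Coord (U′δ b) c` (✓`recordGkJ_inl_eq`), `U′δ = Matrix.of ∘ recordD`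
(✓`hasFDerivAt_bgField_of_entries`), `recordGkLocWξ (b, 𝐔, c) = sl2Coord (of (HrLocξ b)) c` (✓`recordGkLocWξ_inl`), linearity of `sl2Coord`; 𝐉-rows — the linearised current is a
STENCIL of `U′δ` (✓`recordGkJ_inr_eq` ∕ ✓`recordJLocξ_eq`) and the stencil KILLS GRADIENTS (✓`K0AxCtabUniq.stencil_eq_of_sub_grad`), while `recordGradLeg φ′` vanishes there.
This is ✓`K0AxCtabJRows` §2's 𝐉-row argument with the orbit letter in place of the STRUCK (C-tab-opt) receipt: NO weak-criticality ∕ `N(Q′)` ∕ constraint clause, NO Landau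
representative `recordHr`, and NO identity `recordGkL ∕ recordHr ∕ recordD = recordGkLocWξ ∕ recordHrLocξ univ` displayed or derived (J5′: the two responses differ by the
gradient `∇φ`, which the 𝐔-rows ABSORB into the dressing and the 𝐉-rows do not see).
§2 ★★★ `twoVolExp_orbit_of_cmp` — [E] FROM (Tok-cmpU-cap) + D1 + (C-orb) + TokP9reg♭: ★★★`twoVolExp_dressed_of_cmp` (PART B-3) with `φ′ k n` CHOSEN by §1 and HypAn
`ContDiffAt ℝ 2 (recordEmbJ …) 0` DERIVED from the C² entries (✓`PortU8.contDiffAt_recordEmbJ_of`).  WHAT STAYS DISPLAYED (OPEN content, asserted nowhere): D1 (⁸'s mould at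
`recordEmbJ` on `]0, γ₀]`-runs = ⟨27930⟩), (C-orb) `∀ k n a l, RootedResponseOrbitAt …` ([15] (176)–(178) p.306 + [B6] (2.35) p.228, mod P0), TokP9reg♭ `∀ k n, ContDiffAt ℝ 2
(B ↦ entries of recordBgField …) 0` ([15] Prop. 9 p.309; P0), (Tok-cmpU-cap), `McGuard F Mc`, `Mc ≤ Mg`.  (Q-ord): `∃ C₉ δ₀` bound right after the letters it depends on and
before every displayed hypothesis; `φ′` no longer appears (chosen inside).
HONEST: CONDITIONAL theorems; [E] inhabited unconditionally NOWHERE; nothing of Bałaban ([I] Thm 1, (1.18)–(1.22), (4.35)–(4.37); [15] Prop. 9, (176)–(178); [B6] (2.35))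
asserted, ported or discharged; K0ᴬ 27238 ∕ K0⁷ 20541 OPEN; NODE O 0∕1; COUNT 8∕28 · K 1∕4 UNMOVED; finite `𝕋⁴_{L^K}` at fixed ε — NOT continuum ∕ OS ∕ Clay; **the
Yang–Mills mass gap is NOT proved.**  No `instance ∕ notation ∕ allowUnsafeReducibility`; 0 sorry; standard axioms.
-/

noncomputable section

open Filter Topology
open scoped BigOperators Matrix.Norms.L2Operator
open Complex (I)

/-! ## §1  ★★ `DressLink` from the orbit receipt (C-orb) and C² entries -/

namespace Summit.QuantumFields.YangMills.Theorems.K0AxCtabUniq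

open Literature.MathematicalPhysics.QuantumFieldTheory.Balaban1983to89
open Literature.MathematicalPhysics.QuantumFieldTheory.Balaban1983to89.Node00
open Literature.MathematicalPhysics.QuantumFieldTheory.Balaban1983to89.T4Continuum (T4Family)
open Summit.QuantumFields.YangMills.Theorems.K0RecordFormatNames
open Summit.QuantumFields.YangMills.Theorems.K0AxGaugeFlowRec (recordGradLeg sl2Coord_sub)
open Summit.QuantumFields.YangMills.Theorems.PortU8

variable (F : T4Family)

/-- ★★ **`dressLink_of_orbit` — (C-orb) + TokP9reg♭ ⟹ `DressLink`.**  At `θ := thetaFill F a₀ ε₂₉`, `0 < a₀`, `k + 1 ≤ m + K`: if the entries of the rooted background field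
are C² at `B = 0` and every rooted linearised response lies in the gradient orbit of the whole-torus window response (`RootedResponseOrbitAt … a l` for all `a l`), then the
dressing potential `φ′ l a x c := sl2Coord (Matrix.of (φ_{a,l} x)) c` built from the orbit potentials satisfies the receipt `DressLink F θ k K φ′` — 𝐔-rows absorb `∇φ`, 𝐉-rows do
not see it (the linearised current's stencil kills gradients).  CONDITIONAL on its two displayed hypotheses; asserts nothing of Bałaban; K0ᴬ OPEN.
[cite: Balaban1985Variational, (176)–(178) p.306, Prop. 9 p.309; Balaban1984PropagatorsII, (2.35) p.228; Balaban1987RG1, (1.8) p.261, (4.8) p.283, (4.15) p.284, (4.35) p.290] -/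
theorem dressLink_of_orbit (a₀ ε₂₉ : ℝ) (ha₀ : 0 < a₀) (k K : ℕ) (hk : k + 1 ≤ (F.P K).m + (F.P K).K)
    (hd2 : letI θ := thetaFill F a₀ ε₂₉; letI := θ.instVβ₁; letI := θ.instVβ₂; letI := θ.instιβ;
      ContDiffAt ℝ 2 (fun B : recordW F a₀ ε₂₉ k K => fun (b : PBond (F.P K) 0) (i i' : Fin 2) =>
        ((recordBgField F θ k K B b : SU 2) : Matrix (Fin 2) (Fin 2) ℂ) i i') 0)
    (h : ∀ (a : (thetaFill F a₀ ε₂₉).ιβ) (l : RespLabel F k K), RootedResponseOrbitAt F (thetaFill F a₀ ε₂₉) k K a l) :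
    ∃ φ' : RespLabel F k K → (thetaFill F a₀ ε₂₉).ιβ → Site (F.P K) 0 → Fin 3 → ℂ, DressLink F (thetaFill F a₀ ε₂₉) k K φ' := by
  classical
  letI θ := thetaFill F a₀ ε₂₉; letI := θ.instVβ₁; letI := θ.instVβ₂; letI := θ.instιβ
  have hkK : k + 1 ≤ (F.P K).m + (F.P K).K := hk
  -- TokP9reg♭: the rooted field's derivative `U′` with `U′δ = Matrix.of ∘ recordD`, and `ι` differentiable
  obtain ⟨U', hU'eq, hU'⟩ := hasFDerivAt_bgField_of_entries F θ k K (hd2.differentiableAt (by norm_num))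
  have hE : DifferentiableAt ℝ (recordEmbJ F θ k K) 0 :=
    (contDiffAt_recordEmbJ_of F θ k K hkK ha₀ (contDiffAt_matrix_of_entries hd2)).differentiableAt (by norm_num)
  -- the orbit potentials, one per `(a, l)`
  choose φ hφ using h
  refine ⟨fun l a x c => sl2Coord (Matrix.of (φ a l x)) c, fun a l i => ?_⟩
  have hUD : ∀ β : PBond (F.P K) 0, U' (Pi.single l.1 (Pi.single l.2 (θ.bV a))) β = Matrix.of (recordD F θ k K a l β) := fun β => hU'eq _ β
  -- (C-orb), matrix-valued: `U′δ = Matrix.of ∘ recordHrLocξ univ + (ψ(b₋) − ψ(b₊))`, `ψ := −Matrix.of ∘ φ`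
  set ψ : Site (F.P K) 0 → MatA 2 := fun x => -Matrix.of (φ a l x) with hψ
  have hsplit : ∀ β : PBond (F.P K) 0, U' (Pi.single l.1 (Pi.single l.2 (θ.bV a))) β =
      (Matrix.of fun i i' => recordHrLocξ F θ k K Finset.univ a l β i i' : MatA 2) + (ψ β.src - ψ (β.src.shift β.dir)) := by
    intro β
    rw [hUD]
    ext i i'
    have h1 := hφ a l β i i'
    simp only [Matrix.add_apply, Matrix.sub_apply, Matrix.of_apply, hψ, Matrix.neg_apply, PBond.tgt] at h1 ⊢
    linear_combination h1
  obtain ⟨⟨b, t⟩, rfl⟩ := (chartEquivJ F K).surjective i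
  rcases t with c | c
  · -- 𝐔-row: `sl2Coord (of D_b) c + (φ′(b₋) c − φ′(b₊) c) = sl2Coord (of HrLocξ_b) c`
    rw [recordGkJ_inl_eq F θ k K hkK ha₀ U' hU' hE a l b c, recordGkLocWξ_inl, hsplit b, K0RecordFormatNames.sl2Coord_add, sl2Coord_sub]
    simp only [recordGradLeg, Equiv.symm_apply_apply, Sum.elim_inl, Pi.add_apply, Pi.sub_apply, hψ, PBond.tgt]
    have hn : ∀ x : Site (F.P K) 0, sl2Coord (-Matrix.of (φ a l x)) c = -sl2Coord (Matrix.of (φ a l x)) c := by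
      intro x
      have e := sl2Coord_sub 0 (Matrix.of (φ a l x))
      rw [zero_sub, PortU8.sl2Coord_zero, zero_sub] at e
      rw [e, Pi.neg_apply]
    rw [hn, hn]
    ring
  · -- 𝐉-row: the gradient leg vanishes; the stencil kills `∇ψ`
    have h0 : recordGradLeg F K ((fun (l : RespLabel F k K) (a : θ.ιβ) (x : Site (F.P K) 0) (c : Fin 3) => sl2Coord (Matrix.of (φ a l x)) c) l a)
        (chartEquivJ F K (b, Sum.inr c)) = 0 := by
      simp [recordGradLeg]
    rw [h0, add_zero, recordGkJ_inr_eq F θ k K hkK ha₀ U' hU' hE a l b c, recordGkLocWξ_inr, recordJLocξ_eq]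
    congr 3
    rw [stencil_eq_of_sub_grad hsplit b]

end Summit.QuantumFields.YangMills.Theorems.K0AxCtabUniq

/-! ## §2  ★★★ [E] from (Tok-cmpU-cap) + D1 + (C-orb) + TokP9reg♭ -/

namespace Summit.QuantumFields.YangMills.Theorems.K0AxJoinT

open Literature.MathematicalPhysics.QuantumFieldTheory.Balaban1983to89
open Literature.MathematicalPhysics.QuantumFieldTheory.Balaban1983to89.Node00 (betaOfRecord₁₃Ax Stage13Params SU)
open Literature.MathematicalPhysics.QuantumFieldTheory.Balaban1983to89.T4Continuum (T4Family)
open Literature.MathematicalPhysics.QuantumFieldTheory.Balaban1983to89.B12FormatPlus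
open Summit.QuantumFields.YangMills.Theorems.K0RecordFormatNames
open Summit.QuantumFields.YangMills.Theorems.K0AxTwoVolumeRate (RecordPvolTwoVolExpOnRunsAx)
open Literature.MathematicalPhysics.QuantumFieldTheory.Balaban1983to89.FlowStep
open Literature.MathematicalPhysics.QuantumFieldTheory.Balaban1983to89.FlowStepRuns

/-- ★★★ **`twoVolExp_orbit_of_cmp` — (R-a) WITH ITS RECEIPT SUPPLIED: [E] from (Tok-cmpU-cap), D1, the orbit receipt (C-orb) and C² entries.**  For `0 ≤ E₀`, `κ ≥ 4κ₀(64, 8)`,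
`0 < Mg`, `0 ≤ c₁`; every `F a₀ ε₂₉ γ₀ α₀ α₁` with `0 < a₀`, `0 < ε₂₉`, `0 < α₀`, `0 < α₁`; every admissible letter `McGuard F Mc` with `Mc ≤ Mg` and (Tok-cmpU-cap): THERE ARE
`C₉ ≥ 0`, `δ₀ > 0` such that (C-orb) on the record volumes, C² entries of the rooted background field at `B = 0` (TokP9reg♭) and D1 (⁸'s mould at `recordEmbJ` on
`]0, γ₀]`-runs) give [E] `RecordPvolTwoVolExpOnRunsAx F a₀ ε₂₉ γ₀ E (δ₁∕16)` with the constants of ★★★`twoVolExp_LocUniv_of_cmp`.  CONDITIONAL; nothing of Bałaban asserted;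
(C-orb), TokP9reg♭, D1, (Tok-cmpU-cap) OPEN; K0ᴬ OPEN; the Yang–Mills mass gap is NOT proved.
[cite: Balaban1987RG1, Thm 1 p.259, (1.7) p.261, (1.10) p.262, (1.18)–(1.22) pp.263–264, (4.8) p.283, (4.35)–(4.37) pp.290–291, (5.10) p.293; Balaban1985Variational, Prop. 9 p.309, (176)–(178) p.306; Balaban1984PropagatorsII, (2.35) p.228] -/
theorem twoVolExp_orbit_of_cmp {E₀ κ Mg c₁ : ℝ}
    (hE₀ : 0 ≤ E₀) (hκ : 4 * B12TreeDecay.kappa₀ (4 * 2 ^ 4) (2 * 4) ≤ κ) (hMg : 0 < Mg) (hc₁ : 0 ≤ c₁) :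
    ∀ (F : T4Family) (a₀ ε₂₉ γ₀ α₀ α₁ : ℝ), 0 < a₀ → 0 < ε₂₉ → 0 < α₀ → 0 < α₁ → ∀ Mc : ℕ, McGuard F Mc → (Mc : ℝ) ≤ Mg → TokCmpUCap F Mc a₀ →
      ∃ C₉ δ₀ : ℝ, 0 ≤ C₉ ∧ 0 < δ₀ ∧
      letI θ := thetaFill F a₀ ε₂₉; letI := θ.instVβ₁; letI := θ.instVβ₂; letI := θ.instιβ
      (∀ (k n : ℕ) (a : θ.ιβ) (l : RespLabel F k (recordK₀ F Mc k + n)), RootedResponseOrbitAt F θ k (recordK₀ F Mc k + n) a l) →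
      (∀ k n : ℕ, ContDiffAt ℝ 2 (fun B : recordW F a₀ ε₂₉ k (recordK₀ F Mc k + n) => fun (b : PBond (F.P (recordK₀ F Mc k + n)) 0) (i i' : Fin 2) =>
        ((recordBgField F θ k (recordK₀ F Mc k + n) B b : SU 2) : Matrix (Fin 2) (Fin 2) ℂ) i i') 0) →
      ((∀ (k : ℕ) (g : ℕ → ℝ), FlowStep.RGEqH k (betaOfRecord₁₃Ax F 2 (thetaFill F a₀ ε₂₉)) g → Step.InInterval γ₀ k g →
        B12FormatPlus.FormatPlusG (fun n => recordDomSys F Mc k (recordK₀ F Mc k + n)) (fun n => recordBondCount F (recordK₀ F Mc k + n))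
          (fun n => recordAct F (recordK₀ F Mc k + n)) (fun n => recordUc F Mc k α₀ α₁ (recordK₀ F Mc k + n))
          (fun n => recordCoords F Mc k (recordK₀ F Mc k + n)) (fun n => recordChartDimJ F (recordK₀ F Mc k + n))
          (fun n => recordChartJ F Mc k (recordK₀ F Mc k + n)) (fun n => recordΦfAx F a₀ ε₂₉ k (FlowStep.prefixOf g k) (recordK₀ F Mc k + n))
          (fun n => recordEmbJ F θ k (recordK₀ F Mc k + n)) (fun n => recordWrapCtr F Mc k (recordK₀ F Mc k + n))
          (fun n => recordDomEmbCtr F Mc k (recordK₀ F Mc k + n)) (fun n _ => recordCoordProjCtr F (recordK₀ F Mc k + n)) E₀ κ) →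
      RecordPvolTwoVolExpOnRunsAx F a₀ ε₂₉ γ₀
        (48 * E₀ * C₉ ^ 2 * B12TreeDecay.K₀ (4 * 2 ^ 4) (2 * 4) * (2 * (1 - Real.exp (-(δ₀ / 4)))⁻¹) ^ 4 +
          32 * E₀ * C₉ ^ 2 * Real.exp (B12Decay510.delta1 δ₀ κ Mg * Mg * c₁) * B12TreeDecay.K₀ (4 * 2 ^ 4) (2 * 4) * (2 * (1 - Real.exp (-(δ₀ / 4)))⁻¹) ^ 4)
        (B12Decay510.delta1 δ₀ κ Mg * (1 / 16))) := by
  intro F a₀ ε₂₉ γ₀ α₀ α₁ ha₀ hε hα₀ hα₁ Mc hMc hMgMc hcmp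
  letI θ := thetaFill F a₀ ε₂₉; letI := θ.instVβ₁; letI := θ.instVβ₂; letI := θ.instιβ
  obtain ⟨C₉, δ₀, hC₉, hδ₀, h⟩ := twoVolExp_dressed_of_cmp hE₀ hκ hMg hc₁ F a₀ ε₂₉ γ₀ α₀ α₁ ha₀ hε hα₀ hα₁ Mc hMc hMgMc hcmp
  refine ⟨C₉, δ₀, hC₉, hδ₀, fun horb hd2 h8 => ?_⟩
  -- the standing range at the record volumes `K := recordK₀ F Mc k + n`
  have hk : ∀ k n : ℕ, k + 1 ≤ (F.P (recordK₀ F Mc k + n)).m + (F.P (recordK₀ F Mc k + n)).K := fun k n => by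
    simp only [T4Family.P_m, T4Family.P_K, recordK₀]
    omega
  -- §1: the dressing potentials, volume by volume
  choose φ' hφ' using fun k n => K0AxCtabUniq.dressLink_of_orbit F a₀ ε₂₉ ha₀ k (recordK₀ F Mc k + n) (hk k n) (hd2 k n) (horb k n)
  -- HypAn for `recordEmbJ` from the C² entries
  have hAn : ∀ k n : ℕ, ContDiffAt ℝ 2 (recordEmbJ F θ k (recordK₀ F Mc k + n)) 0 := fun k n =>
    PortU8.contDiffAt_recordEmbJ_of F θ k (recordK₀ F Mc k + n) (hk k n) ha₀ (PortU8.contDiffAt_matrix_of_entries (hd2 k n))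
  exact h φ' hφ' hAn h8

end Summit.QuantumFields.YangMills.Theorems.K0AxJoinT

end
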